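import Literature.NumberTheory.GaloisRepresentations.IdeleClassInvariantNaturality
import Literature.NumberTheory.GaloisRepresentations.IdeleInvariantRestriction
import HarnessLib

/-!
# The invariant map of the idèle class formation under restriction:
# `inv_{E/K} (Res α) = [K:F] · inv_{E/F} (α)` for `F ⊆ K ⊆ E` (Serre, *Local Fields* XI §2 axiom (**);
# Tate, C–F VII §11.2 (7), §11.3 (12))

Topic `NumberTheory/GaloisRepresentations`; namespace `Literature.NumberTheory.GaloisRepresentations.IdeleCohomology`.
Sequel to `IdeleClassInvariant.lean` / `IdeleClassInvariantNaturality.lean` (`classInvAll F E`, `classInvAll_classInf`) and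
`IdeleInvariantRestriction.lean` (`inv_ideleRes : inv (Res c) = [K:F] • inv c` on `H²(Gal(E/F), J_E)`).  Definitions with
bodies (the restriction maps on idèle-class cohomology) and theorems; NO named fact, no `sorry`, no instance, no
notation; number fields in `Type`.

Mathematics (Serre XI §2, the second axiom of a class formation: "`inv_{E'} ∘ Res_{E/E'} = [E':E] · inv_E`"; Tate VII
§11.2 (7) / §11.3 (12)).  For a tower `F ⊆ K ⊆ E` of number fields with `E/F` Galois and `α ∈ H²(Gal(E/F), C_E)`:
inflate to the reference compositum `M₁ = E·L'` OVER `K` (`inv ∘ Inf = inv`, previous file), commute `Inf` and `Res`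
(§2), write the reference class `α₁ = ε c₁` of the cyclic layer `L'` and use `Res ∘ ε = ε ∘ Res` (§1) to land on an
idèle class, where `classInvAll ∘ ε = Σ_v inv_v` (previous files) and `Σ_v inv_v (Res c) = [K:F] · Σ_v inv_v (c)`
(`inv_ideleRes`, Tate (7)).

## What is formalised (`F K E : Type` number fields, `IsScalarTower F K E`, `E/F` Galois)

* §1 `classResHom F K E`, **`classRes F K E n : Hⁿ(Gal(E/F), C_E) ⟶ Hⁿ(Gal(E/K), C_E)`** (restriction; door-c4's
  `exists_resCoeffHom` as a definition), `classRes_ideleToClass` (`Res ∘ ε = ε ∘ Res`).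
* §2 `classRes_classInf` (`Res ∘ Inf = Inf ∘ Res` for `F ⊆ K ⊆ E ⊆ M`).
* §3 **`classInvAll_classRes`**: `classInvAll K E (classRes F K E 2 α) = [K:F] • classInvAll F E α`, and the corollary
  `classInvAll_classRes_fundamentalClassAll` (`Res u_{E/F}` has invariant `[K:F]/[E:F] = 1/[E:K]`, hence
  **`classRes_fundamentalClassAll : Res u_{E/F} = u_{E/K}`**, Serre XI §3 "`Res(u_{F/E}) = u_{F/E'}`").

## References
* J.-P. Serre, *Local Fields*, GTM 67 (1979), Ch. XI §2 (axiom (**)), §3 (`Res(u_{F/E}) = u_{F/E'}`). [SerreLocalFields1979]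
* J. W. S. Cassels, A. Fröhlich (eds.), *Algebraic Number Theory* (1967), Ch. VII (J. Tate) §11.2 (7), §11.3 (12).
  [CasselsFrohlichANT1967]
* J. Neukirch, *Class Field Theory — The Bonn Lectures* (2013), Part II §1 Prop. (1.6) b). [Neukirch2013]
-/

noncomputable section

open NumberField IsDedekindDomain CategoryTheory groupCohomology Function
open Literature.NumberTheory.Automorphic

namespace Literature.NumberTheory.GaloisRepresentations

namespace IdeleCohomology

open Literature.NumberTheory.NumberFields Literature.Algebra.Homology
open Literature.AnabelianGeometry.AbsoluteAnabelian.Prop121vii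

/-! ## §1. Restriction on `Hⁿ(Gal(E/F), C_E)` and `Res ∘ ε = ε ∘ Res` -/

section Res

variable (F K E : Type) [Field F] [Field K] [Field E] [NumberField F] [NumberField K] [NumberField E]
  [Algebra F K] [Algebra K E] [Algebra F E] [IsScalarTower F K E]

/-- **The identity `C_E → C_E` as a morphism `Res_{Gal(E/K) → Gal(E/F)} C_E ⟶ C_E`** of `Gal(E/K)`-modules (the action of
`τ ∈ Gal(E/K)` on `C_E` is that of `τ|^F`, the tree's `classGalAct_restrictScalars`; door-c4's `exists_resCoeffHom` as a
definition). [cite: SerreLocalFields1979, Ch. XI §1][cite: CasselsFrohlichANT1967, Ch. VII §8] -/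
def classResHom :
    Rep.res (AlgEquiv.restrictScalarsHom F : (E ≃ₐ[K] E) →* (E ≃ₐ[F] E)) (IdeleClassGroup.galoisRep F E) ⟶
      IdeleClassGroup.galoisRep K E :=
  Rep.ofHom ⟨LinearMap.id, fun τ => LinearMap.ext fun a => by
    change (IdeleClassGroup.galoisRep F E).ρ (AlgEquiv.restrictScalarsHom F τ) a = (IdeleClassGroup.galoisRep K E).ρ τ a
    rw [IdeleClassGroup.galoisRep_ρ_apply, IdeleClassGroup.galoisRep_ρ_apply, AlgEquiv.restrictScalarsHom_apply,
      IdeleClassGroup.classGalAct_restrictScalars]⟩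

omit [NumberField F] [NumberField K] in
/-- Unfolding: `classResHom` is the identity on elements. [cite: SerreLocalFields1979, Ch. XI §1] -/
@[simp] theorem classResHom_hom_apply (a : (IdeleClassGroup.galoisRep F E).V) : (classResHom F K E).hom a = a := rfl

/-- **`Res : Hⁿ(Gal(E/F), C_E) ⟶ Hⁿ(Gal(E/K), C_E)`** along `Gal(E/K) → Gal(E/F)`, `τ ↦ τ|^F`.
[cite: SerreLocalFields1979, Ch. XI §1][cite: CasselsFrohlichANT1967, Ch. VII §11.3 (12)] -/
def classRes (n : ℕ) :
    groupCohomology (IdeleClassGroup.galoisRep F E) n ⟶ groupCohomology (IdeleClassGroup.galoisRep K E) n :=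
  groupCohomology.map (AlgEquiv.restrictScalarsHom F) (classResHom F K E) n

omit [NumberField F] [NumberField K] in
/-- **`Res ∘ ε = ε ∘ Res`**: restriction commutes with `H²(J_E → C_E)`. [cite: CasselsFrohlichANT1967, Ch. VII §11.1] -/
theorem ideleToClass_comp_classRes : ideleToClass F E ≫ classRes F K E 2 = ideleRes F K E 2 ≫ ideleToClass K E := by
  rw [ideleToClass, ideleToClass, groupCohomology.functor_map, groupCohomology.functor_map, ideleRes, classRes,
    ← groupCohomology.map_comp, ← groupCohomology.map_comp]
  exact map_congr' (MonoidHom.ext fun _ => rfl) _ _ (fun _ => rfl) 2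

omit [NumberField F] [NumberField K] in
/-- Element form: `classRes (ε c) = ε (ideleRes c)`. [cite: CasselsFrohlichANT1967, Ch. VII §11.1] -/
theorem classRes_ideleToClass (c : groupCohomology (IdeleClassGroup.ideleRep F E) 2) :
    classRes F K E 2 (ideleToClass F E c) = ideleToClass K E (ideleRes F K E 2 c) := by
  change (ideleToClass F E ≫ classRes F K E 2) c = (ideleRes F K E 2 ≫ ideleToClass K E) c
  rw [ideleToClass_comp_classRes]

end Res

/-! ## §2. `Res ∘ Inf = Inf ∘ Res` -/

section ResInf

variable (F K E M : Type) [Field F] [Field K] [Field E] [Field M] [NumberField F] [NumberField K] [NumberField E]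
  [NumberField M] [Algebra F K] [Algebra K E] [Algebra F E] [IsScalarTower F K E] [Algebra E M] [Algebra F M] [Algebra K M]
  [IsScalarTower F E M] [IsScalarTower K E M] [IsScalarTower F K M] [Normal F E] [Normal K E]

/-- **`Res_{F→K} ∘ Inf_{E→M} = Inf_{E→M} ∘ Res_{F→K}`** on `Hⁿ` of idèle classes (for `σ ∈ Gal(M/K)` the two routes to
`Gal(E/F)` — restrict to `E` then forget `K`, or forget `K` then restrict to `E` — agree; the coefficient maps are both the
base change `C_E → C_M`). [cite: SerreLocalFields1979, Ch. XI §1][cite: CasselsFrohlichANT1967, Ch. VII §11.3 (12)] -/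
theorem classInf_comp_classRes (n : ℕ) :
    classInf F E M n ≫ classRes F K M n = classRes F K E n ≫ classInf K E M n := by
  rw [classInf, classInf, classRes, classRes, ← groupCohomology.map_comp, ← groupCohomology.map_comp]
  refine map_congr' ?_ _ _ (fun _ => rfl) n
  refine MonoidHom.ext fun σ => AlgEquiv.ext fun x => ?_
  apply (algebraMap E M).injective
  change algebraMap E M ((AlgEquiv.restrictNormal (AlgEquiv.restrictScalars F σ) E) x) =
    algebraMap E M ((AlgEquiv.restrictScalars F (AlgEquiv.restrictNormal σ E)) x)
  rw [AlgEquiv.restrictNormal_commutes, AlgEquiv.restrictScalars_apply, AlgEquiv.restrictScalars_apply,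
    AlgEquiv.restrictNormal_commutes]

/-- Element form of `classInf_comp_classRes`. [cite: SerreLocalFields1979, Ch. XI §1] -/
theorem classRes_classInf (n : ℕ) (x : groupCohomology (IdeleClassGroup.galoisRep F E) n) :
    classRes F K M n (classInf F E M n x) = classInf K E M n (classRes F K E n x) := by
  change (classInf F E M n ≫ classRes F K M n) x = (classRes F K E n ≫ classInf K E M n) x
  rw [classInf_comp_classRes]

end ResInf

/-! ## §3. `inv_{E/K} (Res α) = [K:F] · inv_{E/F} (α)` -/

section Main

variable (F K E : Type) [Field F] [Field K] [Field E] [NumberField F] [NumberField K] [NumberField E]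
  [Algebra F K] [Algebra K E] [Algebra F E] [IsScalarTower F K E] [IsGalois F E]

/-- **Serre XI §2 (**): `inv_{E/K} ∘ Res = [K:F] · inv_{E/F}`** for a tower `F ⊆ K ⊆ E` with `E/F` Galois (Tate VII
§11.2 (7) on idèle classes).  Proof: inflate over `K` to the reference compositum `M₁ = E·L'` (`classInvAll_classInf`),
commute `Inf` and `Res`, replace `Inf α` by `Inf α₁ = Inf (ε c₁)` for the reference cyclic class `α₁ = ε c₁`, commute
`Res` and `ε`, and evaluate `classInvAll ∘ ε = Σ_v inv_v` with `inv (Res c) = [K:F] · inv c` (`inv_ideleRes`) and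
`inv (Inf c) = inv c`. [cite: SerreLocalFields1979, Ch. XI §2][cite: CasselsFrohlichANT1967, Ch. VII §11.2 (7)] -/
theorem classInvAll_classRes (α : groupCohomology (IdeleClassGroup.galoisRep F E) 2) :
    haveI : IsGalois K E := IsGalois.tower_top_of_isGalois F K E
    classInvAll K E (classRes F K E 2 α) = Module.finrank F K • classInvAll F E α := by
  haveI : IsGalois K E := IsGalois.tower_top_of_isGalois F K E
  -- the reference datum of `E/F`
  haveI := numberField_refLayer F E
  haveI := isGalois_refLayer F E
  haveI := isCyclic_refLayer F E
  haveI := numberField_refCompositum F E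
  haveI := isGalois_refCompositum F E
  letI := refLayerAlgebra F E
  haveI := isScalarTower_refLayer F E
  -- `M₁ = refCompositum F E` over `K`
  haveI : IsScalarTower F K (refCompositum F E) := IsScalarTower.of_algebraMap_eq fun x => by
    rw [IsScalarTower.algebraMap_apply K E (refCompositum F E), ← IsScalarTower.algebraMap_apply F K E,
      ← IsScalarTower.algebraMap_apply F E (refCompositum F E)]
  haveI : IsGalois K (refCompositum F E) := IsGalois.tower_top_of_isGalois F K (refCompositum F E)
  obtain ⟨c₁, hc₁⟩ := ideleToClass_surjective_of_isCyclic (F := F) (E := refLayer F E) (toRefLayer F E α)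
  have h₁ := classInf_toRefLayer F E α
  rw [← hc₁, classInf_ideleToClass] at h₁
  -- `classInvAll F E α = inv c₁`
  have hR : classInvAll F E α = inv (refLayer F E) c₁ := by
    rw [classInvAll_apply, ← hc₁, classInv_ideleToClass]
  rw [hR, ← classInvAll_classInf K E (refCompositum F E) (classRes F K E 2 α), ← classRes_classInf, ← h₁,
    classRes_ideleToClass, classInvAll_ideleToClass, inv_ideleRes, inv_ideleInf]

/-- **`inv_{E/K} (Res u_{E/F}) = [K:F]/[E:F] (= 1/[E:K])`.** [cite: SerreLocalFields1979, Ch. XI §3] -/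
theorem classInvAll_classRes_fundamentalClassAll :
    haveI : IsGalois K E := IsGalois.tower_top_of_isGalois F K E
    classInvAll K E (classRes F K E 2 (fundamentalClassAll F E)) =
      (haveI := neZero_finrank F E; Module.finrank F K • zmodToQmodZ (Module.finrank F E) 1) := by
  rw [classInvAll_classRes, classInvAll_fundamentalClassAll]

/-- **`Res u_{E/F} = u_{E/K}`** (Serre XI §3: "`Res(u_{F/E}) = u_{F/E'}` if `F ⊃ E' ⊃ E`"; Neukirch II (1.6) b)): the
restriction of the fundamental class of `E/F` to `Gal(E/K)` has invariant `[K:F] · (1/[E:F]) = 1/[E:K]`.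
[cite: SerreLocalFields1979, Ch. XI §3][cite: Neukirch2013, Part II §1 Prop. (1.6) b)] -/
theorem classRes_fundamentalClassAll :
    haveI : IsGalois K E := IsGalois.tower_top_of_isGalois F K E
    classRes F K E 2 (fundamentalClassAll F E) = fundamentalClassAll K E := by
  haveI : IsGalois K E := IsGalois.tower_top_of_isGalois F K E
  haveI := neZero_finrank F E
  haveI := neZero_finrank K E
  refine eq_fundamentalClassAll_of_classInvAll_eq K E ?_
  rw [classInvAll_classRes_fundamentalClassAll, UnitsLayer.zmodToQmodZ_one_eq, UnitsLayer.zmodToQmodZ_one_eq,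
    ← AddCircle.coe_nsmul, nsmul_eq_mul, ← Module.finrank_mul_finrank F K E, Nat.cast_mul]
  congr 1
  have hK : (Module.finrank F K : ℚ) ≠ 0 := Nat.cast_ne_zero.2 Module.finrank_pos.ne'
  have hE : (Module.finrank K E : ℚ) ≠ 0 := Nat.cast_ne_zero.2 Module.finrank_pos.ne'
  field_simp

end Main

end IdeleCohomology

end Literature.NumberTheory.GaloisRepresentations

end
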